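import Summits.QuantumFields.BalabanUV.Beta.GAN24.Push4

/-!
# `BalabanUV.Beta.GAN24.Push4NestTable` — binder row G-an2-4 / (CONV-C), W-slot road «W3» (SKELETON-W3 v0.2 §2 W3-L1 `Push4Nest`, part 1 of 2):
# THE TABLE LEGS OF THE FOUR-LEG PUSH NEST — `vertexW r₁ (vertexW r₂ ·) = vertexW (legComp r₂ r₁)` and the commutation of `vertexW` with
# `ffRead`, with `comp` on either side, and with a `vertexW` acting on another table slot (four dominated Fubini interchanges)

NOT IN PRINT; OUR PROOF ATTEMPT (G-an2-4 formalisation swarm, leaf prover `b2b-balaban-gan24-formalise-leaf-17`, gen 14; companion of `GAN24/Push4`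
p210922; names PROVISIONAL — the row owner gan24-p1 may rename / re-cut).  HONEST FRAMING (cell contract, verbatim): «discharging `BetaPertH` makes
Bałaban's UV stability UNCONDITIONAL — a real constructive-QFT result; it is NOT the continuum limit and NOT the Clay problem.»  HONEST DEPENDENCY
(verbatim): «continuum YM on T⁴ ⇐ BetaPertH ∧ nine spine estimates (0/9 proved); BetaPertH ⇐ (D1) ∧ (D4) ∧ CAP+tail; G-an2-4 gates asym, D1 and
NE2/3/4.»

WHAT.  The nesting law of the push (`Push4Nest`: `push₄ l₁ r₁ (push₄ l₂ r₂ X) = push₄ (legComp l₂ l₁) (legComp r₂ r₁) X`) moves the OUTER table-leg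
superpositions `vertexW r₁` (sums over the middle-level bonds) inside the INNER push's kernel operations (`ffRead`, `comp (Lk l₂) ·`, `comp · (Rk r₂)`) and past
the inner table-leg superpositions `vertexW r₂` (sums over the fine bonds), and then merges `vertexW r₁ ∘ vertexW r₂` into `vertexW (legComp r₂ r₁)`.  Each
move is ONE interchange of a `Σ'` with a `Σ'` (dominated: `KernelWard.tsum_comm_of_prodBound`) or with a finite fibre/direction sum
(`Summable.tsum_finsetSum`), under the minimal hypotheses: the outer weights SUMMABLE in their fine index, the inner weights BOUNDED, the transported
entries summable / bounded as stated.  This module proves the four generic interchange laws; part 2 (`Push4Nest`) adds the kernel-leg re-association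
(`KernelWard.comp_assoc_of_bound` + `Push4.comp_Lk_Lk` / `comp_Rk_Rk`) and assembles the nesting identity under `Push4Bounds.LegDecay` hypotheses.
* `vertexW_ffRead` (no hypothesis), `vertexW_congr` (pointwise agreement of the transported families);
* **`vertexW_vertexW`**: `vertexW r₁ (fun λ v ↦ vertexW r₂ S λ v) μ y = vertexW (legComp r₂ r₁) S μ y` — the `PushSumNest.pushSum_pushSum` twin for table legs
  (the pattern of BCJ's `vertexOf_eq_transportV_of_summable`, whose (K1b′) instance it generalises to arbitrary leg families);
* `vertexW_comp_left` / `vertexW_comp_right`: `vertexW r (fun λ v ↦ comp A (T λ v)) = comp A (vertexW r T)` and the mirror image;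
* `vertexW_comm`: two `vertexW` acting on DIFFERENT table slots commute.
[folklore]; 0 cited facts, 0 `Prop` mirrors, 0 definitions, 0 sorry.  Asserts NO shape of Bałaban's tables; «T2Shape» / «T2SupRate» LOCATED / OPEN, NOT IN
PRINT; discharges NOTHING of (hW, hWall); 0 wall binders instantiated; NOT «W-slot closed», NEVER «G-an2-4 closed»; NOT BetaPertH, NOT continuum, NOT Clay.
-/

noncomputable section

open Finset
open scoped BigOperators
open Literature.MathematicalPhysics.QuantumFieldTheory
open Literature.MathematicalPhysics.QuantumFieldTheory.Balaban1983to89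
open Literature.MathematicalPhysics.QuantumFieldTheory.Balaban1983to89.Beta
open ExpKernelCalculus (MKer comp)
open OneStepResolventKernel (Fib wsum)
open KernelWard (ProdBound tsum_comm_of_prodBound)
open KKTFluctuationEnergy (summable_mul_of_bdd summable_mul_of_bdd')
open BalabanCompositeJets (abs_tsum_mul_le)
open Summit.QuantumFields.BalabanUV.Beta.GAN24.Push4 (legComp legComp_apply vertexW vertexW_apply ffRead ffRead_inl_inl ffRead_inr_left
  ffRead_inr_right)

namespace Summit.QuantumFields.BalabanUV.Beta.GAN24.Push4NestTable

variable {d : ℕ}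
variable {r r₁ r₂ : Fin (d + 1) → (Fin (d + 1) → ℤ) → Fin (d + 1) → (Fin (d + 1) → ℤ) → ℝ}

/-! ## §1 Hypothesis-free moves: `ffRead` and pointwise agreement -/

/-- [folklore] `vertexW` commutes with the ff-corner read (pointwise; no hypothesis). -/
theorem vertexW_ffRead (T : Fin (d + 1) → (Fin (d + 1) → ℤ) → MKer (d + 1) (Fib d)) (μ : Fin (d + 1)) (y : Fin (d + 1) → ℤ) :
    vertexW r (fun lam v => ffRead (T lam v)) μ y = ffRead (vertexW r T μ y) := by
  funext x z a b
  rcases a with α | μ'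
  · rcases b with β | ν
    · simp only [vertexW_apply, ffRead_inl_inl]
    · simp only [vertexW_apply, ffRead_inr_right, mul_zero, tsum_zero, Finset.sum_const_zero]
  · simp only [vertexW_apply, ffRead_inr_left, mul_zero, tsum_zero, Finset.sum_const_zero]

/-- [folklore] `vertexW` depends only on the transported family's values (congruence under pointwise equality). -/
theorem vertexW_congr {S S' : Fin (d + 1) → (Fin (d + 1) → ℤ) → MKer (d + 1) (Fib d)} (h : ∀ κ u, S κ u = S' κ u)
    (μ : Fin (d + 1)) (y : Fin (d + 1) → ℤ) : vertexW r S μ y = vertexW r S' μ y := by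
  have : S = S' := funext fun κ => funext fun u => h κ u
  rw [this]

/-! ## §2 The composition of table legs: `vertexW r₁ ∘ vertexW r₂ = vertexW (legComp r₂ r₁)` -/

/-- [folklore] **TABLE LEGS COMPOSE BY `legComp`**: for outer weights summable in their fine index, inner weights bounded, and a stencil family with
summable slices, `vertexW r₁ (fun λ v ↦ vertexW r₂ S λ v) μ y = vertexW (legComp r₂ r₁) S μ y`.  (One dominated Fubini per direction pair; the
`PushSumNest.pushSum_pushSum` twin for table legs.) -/
theorem vertexW_vertexW {S : Fin (d + 1) → (Fin (d + 1) → ℤ) → MKer (d + 1) (Fib d)} {μ : Fin (d + 1)} {y : Fin (d + 1) → ℤ} {C₂ : ℝ}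
    (hr₁ : ∀ lam, Summable fun v => r₁ μ y lam v) (hr₂ : ∀ lam v κ u, |r₂ lam v κ u| ≤ C₂)
    (hS : ∀ κ x z a b, Summable fun u => S κ u x z a b) :
    vertexW r₁ (fun lam v => vertexW r₂ S lam v) μ y = vertexW (legComp r₂ r₁) S μ y := by
  funext x z a b
  have hC₂ : 0 ≤ C₂ := (abs_nonneg _).trans (hr₂ 0 0 0 0)
  -- notation
  set R : Fin (d + 1) → (Fin (d + 1) → ℤ) → ℝ := fun lam v => r₁ μ y lam v with hR
  set H : Fin (d + 1) → Fin (d + 1) → (Fin (d + 1) → ℤ) → (Fin (d + 1) → ℤ) → ℝ := fun lam κ v u => r₂ lam v κ u with hH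
  set T : Fin (d + 1) → (Fin (d + 1) → ℤ) → ℝ := fun κ u => S κ u x z a b with hT
  have hRs : ∀ lam, Summable (R lam) := hr₁
  have hHle : ∀ lam κ v u, |H lam κ v u| ≤ C₂ := fun lam κ v u => hr₂ lam v κ u
  have hTs : ∀ κ, Summable (T κ) := fun κ => hS κ x z a b
  -- the inner slice `X lam κ v := Σ'_u H · T` and its bound
  set X : Fin (d + 1) → Fin (d + 1) → (Fin (d + 1) → ℤ) → ℝ := fun lam κ v => ∑' u, H lam κ v u * T κ u with hX
  have hXle : ∀ lam κ v, |X lam κ v| ≤ C₂ * ∑' u, |T κ u| := fun lam κ v => abs_tsum_mul_le (fun u => hHle lam κ v u) (hTs κ)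
  -- the composite weight `Y lam κ u := Σ'_v R · H` and its bound
  set Y : Fin (d + 1) → Fin (d + 1) → (Fin (d + 1) → ℤ) → ℝ := fun lam κ u => ∑' v, R lam v * H lam κ v u with hY
  have hYle : ∀ lam κ u, |Y lam κ u| ≤ C₂ * ∑' v, |R lam v| := by
    intro lam κ u
    have h := abs_tsum_mul_le (H := fun v => H lam κ v u) (T := R lam) (fun v => hHle lam κ v u) (hRs lam)
    have e : (∑' v, H lam κ v u * R lam v) = Y lam κ u := tsum_congr fun v => mul_comm _ _
    rw [e] at h
    exact h
  -- LEFT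
  have lhs : vertexW r₁ (fun lam v => vertexW r₂ S lam v) μ y x z a b = ∑ lam, ∑' v, R lam v * ∑ κ, X lam κ v := by
    simp only [vertexW_apply]
    rfl
  -- per `lam`: distribute, Fubini, regroup
  have mid : ∀ lam, (∑' v, R lam v * ∑ κ, X lam κ v) = ∑ κ, ∑' u, Y lam κ u * T κ u := by
    intro lam
    have hsv : ∀ κ ∈ (Finset.univ : Finset (Fin (d + 1))), Summable fun v => R lam v * X lam κ v := fun κ _ =>
      summable_mul_of_bdd' (hRs lam) (fun v => hXle lam κ v)
    calc (∑' v, R lam v * ∑ κ, X lam κ v) = ∑' v, ∑ κ, R lam v * X lam κ v := tsum_congr fun v => Finset.mul_sum _ _ _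
      _ = ∑ κ, ∑' v, R lam v * X lam κ v := Summable.tsum_finsetSum hsv
      _ = ∑ κ, ∑' u, Y lam κ u * T κ u := Finset.sum_congr rfl fun κ _ => ?_
    -- Fubini for the pair (v, u)
    have hPB : ProdBound (fun v u => R lam v * (H lam κ v u * T κ u)) := by
      refine ⟨fun v => |R lam v|, fun u => C₂ * |T κ u|, (hRs lam).abs, (hTs κ).abs.mul_left C₂, fun v => abs_nonneg _,
        fun u => mul_nonneg hC₂ (abs_nonneg _), fun v u => ?_⟩
      rw [abs_mul, abs_mul]
      calc |R lam v| * (|H lam κ v u| * |T κ u|) ≤ |R lam v| * (C₂ * |T κ u|) :=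
            mul_le_mul_of_nonneg_left (mul_le_mul_of_nonneg_right (hHle lam κ v u) (abs_nonneg _)) (abs_nonneg _)
        _ = _ := rfl
    calc (∑' v, R lam v * X lam κ v) = ∑' v, ∑' u, R lam v * (H lam κ v u * T κ u) := tsum_congr fun v => tsum_mul_left.symm
      _ = ∑' u, ∑' v, R lam v * (H lam κ v u * T κ u) := tsum_comm_of_prodBound hPB
      _ = ∑' u, Y lam κ u * T κ u := tsum_congr fun u => by
          rw [← tsum_mul_right]
          exact tsum_congr fun v => (mul_assoc _ _ _).symm
  -- RIGHT
  have rhs : vertexW (legComp r₂ r₁) S μ y x z a b = ∑ κ, ∑' u, (∑ lam, Y lam κ u) * T κ u := by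
    simp only [vertexW_apply, legComp_apply]
    refine Finset.sum_congr rfl fun κ _ => tsum_congr fun u => ?_
    congr 1
    have hsl : ∀ lam ∈ (Finset.univ : Finset (Fin (d + 1))), Summable fun v => R lam v * H lam κ v u := fun lam _ =>
      summable_mul_of_bdd' (hRs lam) (fun v => hHle lam κ v u)
    exact Summable.tsum_finsetSum hsl
  rw [lhs, rhs, Finset.sum_congr rfl fun lam _ => mid lam, Finset.sum_comm]
  refine Finset.sum_congr rfl fun κ _ => ?_
  have hsu : ∀ lam ∈ (Finset.univ : Finset (Fin (d + 1))), Summable fun u => Y lam κ u * T κ u := fun lam _ =>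
    summable_mul_of_bdd (fun u => hYle lam κ u) (hTs κ)
  rw [← Summable.tsum_finsetSum hsu]
  exact tsum_congr fun u => (Finset.sum_mul _ _ _).symm

/-! ## §3 `vertexW` commutes with a left / right composition acting on the kernel indices -/

/-- [folklore] **`vertexW` PAST A LEFT COMPOSITION**: weights summable in their fine index, `A` with summable rows, transported kernels bounded ⟹
`vertexW r (fun λ v ↦ comp A (T λ v)) μ y = comp A (vertexW r T μ y)`. -/
theorem vertexW_comp_left {A : MKer (d + 1) (Fib d)} {T : Fin (d + 1) → (Fin (d + 1) → ℤ) → MKer (d + 1) (Fib d)} {μ : Fin (d + 1)}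
    {y : Fin (d + 1) → ℤ} {CT : ℝ} (hr : ∀ lam, Summable fun v => r μ y lam v) (hA : ∀ x a f, Summable fun w => A x w a f)
    (hT : ∀ lam v w z f b, |T lam v w z f b| ≤ CT) :
    vertexW r (fun lam v => comp A (T lam v)) μ y = comp A (vertexW r T μ y) := by
  funext x z a b
  have hCT : 0 ≤ CT := (abs_nonneg _).trans (hT 0 0 0 0 (Sum.inl 0) (Sum.inl 0))
  set R : Fin (d + 1) → (Fin (d + 1) → ℤ) → ℝ := fun lam v => r μ y lam v with hR
  -- the slice `Z lam f w := Σ'_v R · T(w, f)` and its bound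
  set Z : Fin (d + 1) → Fib d → (Fin (d + 1) → ℤ) → ℝ := fun lam f w => ∑' v, R lam v * T lam v w z f b with hZ
  have hZle : ∀ lam f w, |Z lam f w| ≤ CT * ∑' v, |R lam v| := by
    intro lam f w
    have h := abs_tsum_mul_le (H := fun v => T lam v w z f b) (T := R lam) (fun v => hT lam v w z f b) (hr lam)
    have e : (∑' v, T lam v w z f b * R lam v) = Z lam f w := tsum_congr fun v => mul_comm _ _
    rw [e] at h
    exact h
  -- per `lam`
  have mid : ∀ lam, (∑' v, R lam v * comp A (T lam v) x z a b) = ∑' w, ∑ f, A x w a f * Z lam f w := by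
    intro lam
    have hPB : ProdBound (fun v w => R lam v * ∑ f, A x w a f * T lam v w z f b) := by
      refine ⟨fun v => |R lam v|, fun w => CT * ∑ f, |A x w a f|, (hr lam).abs,
        (summable_sum fun f _ => (hA x a f).abs).mul_left CT, fun v => abs_nonneg _,
        fun w => mul_nonneg hCT (Finset.sum_nonneg fun f _ => abs_nonneg _), fun v w => ?_⟩
      rw [abs_mul]
      refine mul_le_mul_of_nonneg_left ?_ (abs_nonneg _)
      calc |∑ f, A x w a f * T lam v w z f b| ≤ ∑ f, |A x w a f * T lam v w z f b| := Finset.abs_sum_le_sum_abs _ _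
        _ ≤ ∑ f, |A x w a f| * CT := Finset.sum_le_sum fun f _ => by
            rw [abs_mul]; exact mul_le_mul_of_nonneg_left (hT lam v w z f b) (abs_nonneg _)
        _ = CT * ∑ f, |A x w a f| := by rw [Finset.mul_sum]; exact Finset.sum_congr rfl fun f _ => mul_comm _ _
    calc (∑' v, R lam v * comp A (T lam v) x z a b) = ∑' v, ∑' w, R lam v * ∑ f, A x w a f * T lam v w z f b :=
          tsum_congr fun v => by simp only [comp]; exact tsum_mul_left.symm
      _ = ∑' w, ∑' v, R lam v * ∑ f, A x w a f * T lam v w z f b := tsum_comm_of_prodBound hPB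
      _ = ∑' w, ∑ f, A x w a f * Z lam f w := tsum_congr fun w => by
          have hsf : ∀ f ∈ (Finset.univ : Finset (Fib d)), Summable fun v => A x w a f * (R lam v * T lam v w z f b) := fun f _ =>
            (summable_mul_of_bdd' (hr lam) (fun v => hT lam v w z f b)).mul_left (A x w a f)
          calc (∑' v, R lam v * ∑ f, A x w a f * T lam v w z f b) = ∑' v, ∑ f, A x w a f * (R lam v * T lam v w z f b) :=
                tsum_congr fun v => by rw [Finset.mul_sum]; exact Finset.sum_congr rfl fun f _ => by ring
            _ = ∑ f, ∑' v, A x w a f * (R lam v * T lam v w z f b) := Summable.tsum_finsetSum hsf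
            _ = ∑ f, A x w a f * Z lam f w := Finset.sum_congr rfl fun f _ => tsum_mul_left
  -- assemble
  have lhs : vertexW r (fun lam v => comp A (T lam v)) μ y x z a b = ∑ lam, ∑' v, R lam v * comp A (T lam v) x z a b := by
    simp only [vertexW_apply]
    rfl
  have rhs : comp A (vertexW r T μ y) x z a b = ∑' w, ∑ f, A x w a f * ∑ lam, Z lam f w := by
    simp only [comp, vertexW_apply]
    rfl
  have hsw : ∀ lam ∈ (Finset.univ : Finset (Fin (d + 1))), Summable fun w => ∑ f, A x w a f * Z lam f w := fun lam _ =>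
    summable_sum fun f _ => summable_mul_of_bdd' (hA x a f) (fun w => hZle lam f w)
  rw [lhs, rhs, Finset.sum_congr rfl fun lam _ => mid lam, ← Summable.tsum_finsetSum hsw]
  refine tsum_congr fun w => ?_
  rw [Finset.sum_comm]
  exact Finset.sum_congr rfl fun f _ => by rw [Finset.mul_sum]

/-- [folklore] **`vertexW` PAST A RIGHT COMPOSITION**: weights summable in their fine index, `B` with summable columns, transported kernels bounded ⟹
`vertexW r (fun λ v ↦ comp (T λ v) B) μ y = comp (vertexW r T μ y) B`. -/
theorem vertexW_comp_right {B : MKer (d + 1) (Fib d)} {T : Fin (d + 1) → (Fin (d + 1) → ℤ) → MKer (d + 1) (Fib d)} {μ : Fin (d + 1)}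
    {y : Fin (d + 1) → ℤ} {CT : ℝ} (hr : ∀ lam, Summable fun v => r μ y lam v) (hB : ∀ z f b, Summable fun w => B w z f b)
    (hT : ∀ lam v x w a f, |T lam v x w a f| ≤ CT) :
    vertexW r (fun lam v => comp (T lam v) B) μ y = comp (vertexW r T μ y) B := by
  funext x z a b
  have hCT : 0 ≤ CT := (abs_nonneg _).trans (hT 0 0 0 0 (Sum.inl 0) (Sum.inl 0))
  set R : Fin (d + 1) → (Fin (d + 1) → ℤ) → ℝ := fun lam v => r μ y lam v with hR
  set Z : Fin (d + 1) → Fib d → (Fin (d + 1) → ℤ) → ℝ := fun lam f w => ∑' v, R lam v * T lam v x w a f with hZ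
  have hZle : ∀ lam f w, |Z lam f w| ≤ CT * ∑' v, |R lam v| := by
    intro lam f w
    have h := abs_tsum_mul_le (H := fun v => T lam v x w a f) (T := R lam) (fun v => hT lam v x w a f) (hr lam)
    have e : (∑' v, T lam v x w a f * R lam v) = Z lam f w := tsum_congr fun v => mul_comm _ _
    rw [e] at h
    exact h
  have mid : ∀ lam, (∑' v, R lam v * comp (T lam v) B x z a b) = ∑' w, ∑ f, Z lam f w * B w z f b := by
    intro lam
    have hPB : ProdBound (fun v w => R lam v * ∑ f, T lam v x w a f * B w z f b) := by
      refine ⟨fun v => |R lam v|, fun w => CT * ∑ f, |B w z f b|, (hr lam).abs,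
        (summable_sum fun f _ => (hB z f b).abs).mul_left CT, fun v => abs_nonneg _,
        fun w => mul_nonneg hCT (Finset.sum_nonneg fun f _ => abs_nonneg _), fun v w => ?_⟩
      rw [abs_mul]
      refine mul_le_mul_of_nonneg_left ?_ (abs_nonneg _)
      calc |∑ f, T lam v x w a f * B w z f b| ≤ ∑ f, |T lam v x w a f * B w z f b| := Finset.abs_sum_le_sum_abs _ _
        _ ≤ ∑ f, CT * |B w z f b| := Finset.sum_le_sum fun f _ => by
            rw [abs_mul]; exact mul_le_mul_of_nonneg_right (hT lam v x w a f) (abs_nonneg _)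
        _ = CT * ∑ f, |B w z f b| := by rw [Finset.mul_sum]
    calc (∑' v, R lam v * comp (T lam v) B x z a b) = ∑' v, ∑' w, R lam v * ∑ f, T lam v x w a f * B w z f b :=
          tsum_congr fun v => by simp only [comp]; exact tsum_mul_left.symm
      _ = ∑' w, ∑' v, R lam v * ∑ f, T lam v x w a f * B w z f b := tsum_comm_of_prodBound hPB
      _ = ∑' w, ∑ f, Z lam f w * B w z f b := tsum_congr fun w => by
          have hsf : ∀ f ∈ (Finset.univ : Finset (Fib d)), Summable fun v => (R lam v * T lam v x w a f) * B w z f b := fun f _ =>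
            (summable_mul_of_bdd' (hr lam) (fun v => hT lam v x w a f)).mul_right (B w z f b)
          calc (∑' v, R lam v * ∑ f, T lam v x w a f * B w z f b) = ∑' v, ∑ f, (R lam v * T lam v x w a f) * B w z f b :=
                tsum_congr fun v => by rw [Finset.mul_sum]; exact Finset.sum_congr rfl fun f _ => by ring
            _ = ∑ f, ∑' v, (R lam v * T lam v x w a f) * B w z f b := Summable.tsum_finsetSum hsf
            _ = ∑ f, Z lam f w * B w z f b := Finset.sum_congr rfl fun f _ => tsum_mul_right
  have lhs : vertexW r (fun lam v => comp (T lam v) B) μ y x z a b = ∑ lam, ∑' v, R lam v * comp (T lam v) B x z a b := by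
    simp only [vertexW_apply]
    rfl
  have rhs : comp (vertexW r T μ y) B x z a b = ∑' w, ∑ f, (∑ lam, Z lam f w) * B w z f b := by
    simp only [comp, vertexW_apply]
    rfl
  have hsw : ∀ lam ∈ (Finset.univ : Finset (Fin (d + 1))), Summable fun w => ∑ f, Z lam f w * B w z f b := fun lam _ =>
    summable_sum fun f _ => summable_mul_of_bdd (fun w => hZle lam f w) (hB z f b)
  rw [lhs, rhs, Finset.sum_congr rfl fun lam _ => mid lam, ← Summable.tsum_finsetSum hsw]
  refine tsum_congr fun w => ?_
  rw [Finset.sum_comm]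
  exact Finset.sum_congr rfl fun f _ => by rw [Finset.sum_mul]

/-! ## §4 Two table-leg superpositions on different slots commute -/

/-- [folklore] **`vertexW` ON DIFFERENT SLOTS COMMUTE**: outer weights summable, inner weights bounded, and the doubly-indexed family dominated in the
inner fine index uniformly in the outer one ⟹ the two superpositions may be exchanged. -/
theorem vertexW_comm {G : Fin (d + 1) → (Fin (d + 1) → ℤ) → Fin (d + 1) → (Fin (d + 1) → ℤ) → MKer (d + 1) (Fib d)}
    {ν : Fin (d + 1)} {y' : Fin (d + 1) → ℤ} {lam : Fin (d + 1)} {v : Fin (d + 1) → ℤ} {C₂ : ℝ}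
    (hr₁ : ∀ l', Summable fun v' => r₁ ν y' l' v') (hr₂ : ∀ κ u, |r₂ lam v κ u| ≤ C₂)
    (hG : ∀ κ x z a b, ∃ g : (Fin (d + 1) → ℤ) → ℝ, Summable g ∧ ∀ u l' v', |G κ u l' v' x z a b| ≤ g u) :
    vertexW r₁ (fun l' v' => vertexW r₂ (fun κ u => G κ u l' v') lam v) ν y'
      = vertexW r₂ (fun κ u => vertexW r₁ (fun l' v' => G κ u l' v') ν y') lam v := by
  funext x z a b
  have hC₂ : 0 ≤ C₂ := (abs_nonneg _).trans (hr₂ 0 0)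
  set R : Fin (d + 1) → (Fin (d + 1) → ℤ) → ℝ := fun l' v' => r₁ ν y' l' v' with hR
  set H : Fin (d + 1) → (Fin (d + 1) → ℤ) → ℝ := fun κ u => r₂ lam v κ u with hH
  set F : Fin (d + 1) → (Fin (d + 1) → ℤ) → Fin (d + 1) → (Fin (d + 1) → ℤ) → ℝ := fun κ u l' v' => G κ u l' v' x z a b with hF
  -- LHS = Σ_l' Σ'_v' R · Σ_κ Σ'_u H · F ; RHS = Σ_κ Σ'_u H · Σ_l' Σ'_v' R · F
  have lhs : vertexW r₁ (fun l' v' => vertexW r₂ (fun κ u => G κ u l' v') lam v) ν y' x z a b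
      = ∑ l', ∑' v', R l' v' * ∑ κ, ∑' u, H κ u * F κ u l' v' := by
    simp only [vertexW_apply]
    rfl
  have rhs : vertexW r₂ (fun κ u => vertexW r₁ (fun l' v' => G κ u l' v') ν y') lam v x z a b
      = ∑ κ, ∑' u, H κ u * ∑ l', ∑' v', R l' v' * F κ u l' v' := by
    simp only [vertexW_apply]
    rfl
  -- per (l', κ): Fubini over (v', u)
  have key : ∀ l' κ, (∑' v', R l' v' * ∑' u, H κ u * F κ u l' v') = ∑' u, H κ u * ∑' v', R l' v' * F κ u l' v' := by
    intro l' κ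
    obtain ⟨g, hg, hgle⟩ := hG κ x z a b
    have hg0 : ∀ u, 0 ≤ g u := fun u => (abs_nonneg _).trans (hgle u l' 0)
    have hPB : ProdBound (fun v' u => R l' v' * (H κ u * F κ u l' v')) := by
      refine ⟨fun v' => |R l' v'|, fun u => C₂ * g u, (hr₁ l').abs, hg.mul_left C₂, fun v' => abs_nonneg _,
        fun u => mul_nonneg hC₂ (hg0 u), fun v' u => ?_⟩
      rw [abs_mul, abs_mul]
      exact mul_le_mul_of_nonneg_left (mul_le_mul (hr₂ κ u) (hgle u l' v') (abs_nonneg _) hC₂) (abs_nonneg _)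
    calc (∑' v', R l' v' * ∑' u, H κ u * F κ u l' v') = ∑' v', ∑' u, R l' v' * (H κ u * F κ u l' v') :=
          tsum_congr fun v' => tsum_mul_left.symm
      _ = ∑' u, ∑' v', R l' v' * (H κ u * F κ u l' v') := tsum_comm_of_prodBound hPB
      _ = ∑' u, H κ u * ∑' v', R l' v' * F κ u l' v' := tsum_congr fun u => by
          rw [← tsum_mul_left]
          exact tsum_congr fun v' => by ring
  -- summability of the per-(l', κ) slices in the two outer variables
  have hsv : ∀ l', ∀ κ ∈ (Finset.univ : Finset (Fin (d + 1))), Summable fun v' => R l' v' * ∑' u, H κ u * F κ u l' v' := by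
    intro l' κ _
    obtain ⟨g, hg, hgle⟩ := hG κ x z a b
    refine summable_mul_of_bdd' (hr₁ l') (M := C₂ * ∑' u, g u) (fun v' => ?_)
    have hs : Summable fun u => C₂ * g u := hg.mul_left C₂
    have hb := tsum_of_norm_bounded hs.hasSum (f := fun u => H κ u * F κ u l' v') (fun u => by
      rw [Real.norm_eq_abs, abs_mul]
      exact mul_le_mul (hr₂ κ u) (hgle u l' v') (abs_nonneg _) hC₂)
    rw [Real.norm_eq_abs, tsum_mul_left] at hb
    exact hb
  have hsu : ∀ κ, ∀ l' ∈ (Finset.univ : Finset (Fin (d + 1))), Summable fun u => H κ u * ∑' v', R l' v' * F κ u l' v' := by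
    intro κ l' _
    obtain ⟨g, hg, hgle⟩ := hG κ x z a b
    refine summable_mul_of_bdd (M := C₂) (fun u => hr₂ κ u) ?_
    refine Summable.of_norm_bounded (hg.mul_left (∑' v', |R l' v'|)) (fun u => ?_)
    rw [Real.norm_eq_abs]
    have h := abs_tsum_mul_le (H := fun v' => F κ u l' v') (T := R l') (fun v' => hgle u l' v') (hr₁ l')
    have e : (∑' v', F κ u l' v' * R l' v') = ∑' v', R l' v' * F κ u l' v' := tsum_congr fun v' => mul_comm _ _
    rw [e] at h
    rw [mul_comm]
    exact h
  rw [lhs, rhs]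
  calc (∑ l', ∑' v', R l' v' * ∑ κ, ∑' u, H κ u * F κ u l' v')
      = ∑ l', ∑' v', ∑ κ, R l' v' * ∑' u, H κ u * F κ u l' v' := Finset.sum_congr rfl fun l' _ =>
        tsum_congr fun v' => Finset.mul_sum _ _ _
    _ = ∑ l', ∑ κ, ∑' v', R l' v' * ∑' u, H κ u * F κ u l' v' := Finset.sum_congr rfl fun l' _ =>
        Summable.tsum_finsetSum (hsv l')
    _ = ∑ l', ∑ κ, ∑' u, H κ u * ∑' v', R l' v' * F κ u l' v' := Finset.sum_congr rfl fun l' _ =>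
        Finset.sum_congr rfl fun κ _ => key l' κ
    _ = ∑ κ, ∑ l', ∑' u, H κ u * ∑' v', R l' v' * F κ u l' v' := Finset.sum_comm
    _ = ∑ κ, ∑' u, ∑ l', H κ u * ∑' v', R l' v' * F κ u l' v' := Finset.sum_congr rfl fun κ _ =>
        (Summable.tsum_finsetSum (hsu κ)).symm
    _ = ∑ κ, ∑' u, H κ u * ∑ l', ∑' v', R l' v' * F κ u l' v' := Finset.sum_congr rfl fun κ _ =>
        tsum_congr fun u => (Finset.mul_sum _ _ _).symm

end Summit.QuantumFields.BalabanUV.Beta.GAN24.Push4NestTable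

end
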